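import Literature.AnabelianGeometry.EtaleTheta.DivisorMonoidsOfGaloisCoveringCoset
import Literature.AnabelianGeometry.EtaleTheta.TemperedFrobenioidModel
import Literature.AnabelianGeometry.EtaleTheta.ThetaFrobenioid

/-!
# [EtTh] Def. 3.6 (i) data along a functor, and RE-BASING a tempered Frobenioid onto its own base category:
# Example 3.9 (iv) at `α = 𝟙_A` («`D_X` … special cases of `D_α`», p. 311) — class (b) construction

S. Mochizuki, *The étale theta function and its Frobenioid-theoretic manifestations*, Publ. RIMS **45** (2009)
[MochizukiEtTh2009].  Def. 3.6 (i)/(ii) pp. 302–303 (PDF pp. 76–77): «Let `D` be a connected, totally epimorphic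
category, equipped with a functor `D → D₀` … `Φ ⊆ Φ^{ℝ-log} := Φ₀^ℝ|_D` …»; Example 3.9 (iv) p. 311 (PDF p. 85):
«`D_α := (D_W)_B[α] (⊆ (D_W)_B)` … we observe that `D_W`, `D_X`, `D_Y`, `D_U` are special cases of "`D_α`" [obtained
by taking "`α`" to be the identity morphism of `W^log`, `X^log`, `Y^log`, `U^log`] … `Φ^ell_α := Φ^ell_W|_{D_α}`»;
§4 p. 312 (PDF p. 86): «we fix a tempered Frobenioid `C` … whose base category `D` is of the form `D := D₀[𝒟] (⊆ D₀)`»;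
§5 p. 322 (PDF p. 96): «we return to the situation of Example 3.9.  Suppose further that the morphism `α : A → B` of
Example 3.9, (iv), is the identity morphism, and that "`A`" is one of the smooth log orbicurves … the divisor monoid
`Φ := Φ^ell_α` on `D := D_α` … determines a tempered Frobenioid `C` of monoid type `ℤ` over the base category `D`».
[cite: MochizukiEtTh2009, Def 3.6 p.302 (PDF p.76); Ex 3.9 (iv) p.311 (PDF p.85); §4 p.312 (PDF p.86); §5 p.322 (PDF p.96)]

abc-iut cell, layer L2, seat abc-iut-L2-t4 (gen 5; the §5 owner lineage), census item **B9 option (B)** of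
`plan/L2/VNEXT-CENSUS-L2.md` (chair's ruling F3: «BOOK "Ex 3.9 (iv) RE-BASING constructor at α = 𝟙_A" as a
junction-time class (b) row (L2-t4 / L2-t9 lineage)»; memo `HOME/staging/L2/L2-t9/census/VNEXT-Thm44HypBaseShape.md`).
CLASS (b) CONSTRUCTION: three `def`s over EXISTING interfaces (abc-iut-L2-t3's `RealifiedDivisorMonoids`,
`TemperedFrobenioid`, `Example39Data`; abc-iut-w5-d179's `DivisorMonoids.precomp`, consumed BY NAME), 0 structures /
instances / notation / `Prop` facts; nothing landed is edited or restated.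

WHY.  abc-iut-L2-t3's `Example39Data.thetaFrobenioid α h : TemperedFrobenioid TW (Dα α) VD` is referenced to `D_W`
(`base := toDW α : D_α ⥤ D_W`, the Def. 3.3 data `TW` living on `D_W`).  §4 and §5, however, apply the theory with
`D₀ := B^temp(A^log)⁰ ≅ (D_W)_A = D_{𝟙_A}` as the reference category and `D = D₀` (print's «special cases»), and
abc-iut-L2-t3's `BiKummerSetting.Thm44Hyp.baseShape_i` reads «`D_i = D₀[𝒟_i]`» RELATIVE TO THE REFERENCE CATEGORY of the
datum: `tf.base.Full ∧ tf.base.Faithful ∧ ∃ 𝒟, essImage = D₀[𝒟]`.  abc-iut-L2-t9's certificates (p432820,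
`Discharge/Sec5Prop51Thm44Pin.lean` §5) show that for the UN-re-based datum the clause «Full» fails as soon as `A` has a
non-trivial `D_W`-endomorphism (`Example39Data.not_full_toDW_id_of_ne`) — print silently re-bases.  This file makes the
re-basing a constructor:

* §1 `RealifiedDivisorMonoids.precomp T F` — the Def. 3.6 (i) data `(Φ₀, B₀, …, Φ₀^ℝ, B₀^Λ, F₀^Λ, ℝ·Φ₀^cnst, …)` over `D₀`
  whiskered along ANY functor `F : D₁ ⥤ D₀` (every functor precomposed with `F.op`, every objectwise datum and law
  read at `F Y`); its Def. 3.3 (iii) part IS abc-iut-w5-d179's `DivisorMonoids.precomp` (by `rfl`);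
* §2 `TemperedFrobenioid.rebase C : TemperedFrobenioid (T.precomp C.base) D VD` — the SAME Def. 3.6 (ii) datum
  `(D, Φ, B, B → Φ^gp)` re-referenced to `D₀ := D` with `base := 𝟭 D`: the divisor monoid, the rational-function monoid,
  `Div_B`, hence THE MODEL CATEGORY, its pre-Frobenioid structure and units are UNCHANGED (`divisorMonoid_rebase`,
  `ratFnFunctor_rebase`, `category_rebase`, … — all `rfl`), and the three clauses of `Thm44Hyp.baseShape_i` HOLD for it
  as soon as `D` has a weakly terminal object (`baseShape_rebase`);
* §3 `Example39Data.thetaFrobenioidRebase E A h` — Example 3.9 (iv) at `α = 𝟙_A` re-referenced to `(D_W)_A = D_{𝟙_A}`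
  (print's §5 choice), with `baseShape_thetaFrobenioidRebase` (the weakly terminal object is `(A, 𝟙_A)`, abc-iut-L2-t3's
  `admitsMorphismTo_mk_id`).
NOT here (named, not rebuilt): the equivalence `(D_W)_A ≌ B^temp(Π_A)⁰` ([FrdII] Ex. 1.3 (i), abc-iut-L1's
`QuasiTemperoid.InductionEquivalence` lineage) and the assembly of `Thm44Hyp S S` (abc-iut-L2-t9's `exists_thm44Hyp_self`,
abc-iut-w4-d008's equivalence form — proof-only sequels).  UNIVERSE NOTE (honest): `BiKummerSetting X T D VD` pins the
reference category to `Type u₀`, the universe of the base field `K`; a re-based datum has `D₀ := D`, so over the LARGE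
genuine base `ConnectedPart (BTemp Π) : Type (u₀+1)` the re-based `tf` does not fit a `BiKummerSetting` — there one
re-bases onto a SMALL model of the base (e.g. abc-iut-w5-d179's coset model) along an equivalence, i.e. `precomp` along the
model's inclusion; the constructor below is stated for arbitrary `F`, `D` so that both uses are instances.
HONEST FRAMING: constructions over abc-iut-L2-t3's typed interfaces; nothing asserts that the data exist for an actual
curve; no side is taken on anything downstream ([IUTchIII] Cor. 3.12); typed ≠ proved.
-/

noncomputable section

namespace Literature.AnabelianGeometry.EtaleTheta

open CategoryTheory Opposite Literature.AlgebraicGeometry.Frobenioids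

universe u₀ v₀ u₁ v₁ u v w

/-! ## §1. Def. 3.6 (i) data whiskered along a functor -/

namespace RealifiedDivisorMonoids

variable {D₀ : Type u₀} [Category.{v₀} D₀] {V : FrdIMonoidStub.{w}} (T : RealifiedDivisorMonoids (D₀ := D₀) V)
  {D₁ : Type u₁} [Category.{v₁} D₁] (F : D₁ ⥤ D₀)

/-- **Base change of the Def. 3.6 (i) data along a functor** `F : D₁ ⥤ D₀`: the realified data
`(Φ₀^ℝ, Φ₀ → Φ₀^ℝ, B₀^Λ, B₀^Λ → (Φ₀^ℝ)^gp, F₀^Λ, ℝ·Φ₀^cnst, (non-)cuspidal parts)` and all their laws read at `F Y`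
(«equipped with a functor `D → D₀` … `Φ^{ℝ-log} := Φ₀^ℝ|_D`», Def. 3.6 (ii) p.302; «`Φ^ell_α := Φ^ell_W|_{D_α}` … obtained
simply by restricting the functor `Φ^ell_W` via some functor», Ex. 3.9 (iv) p.311), on top of abc-iut-w5-d179's
`DivisorMonoids.precomp` for the Def. 3.3 (iii) part.  The monoid type `Λ` is unchanged.
[cite: MochizukiEtTh2009, Def 3.6 p.302 (PDF p.76); Ex 3.9 (iv) p.311 (PDF p.85)] -/
def precomp : RealifiedDivisorMonoids (D₀ := D₁) V where
  toDivisorMonoids := T.toDivisorMonoids.precomp F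
  Λ := T.Λ
  ΦR := F.op ⋙ T.ΦR
  toR Y := T.toR (op (F.obj Y.unop))
  toR_natural f x := T.toR_natural (F.map f.unop).op x
  isRealification Y := T.isRealification (op (F.obj Y.unop))
  BΛ := F.op ⋙ T.BΛ
  isUnit_BΛ Y b := T.isUnit_BΛ (op (F.obj Y.unop)) b
  divΛ Y := T.divΛ (op (F.obj Y.unop))
  divΛ_natural f b := T.divΛ_natural (F.map f.unop).op b
  FΛ Y := T.FΛ (op (F.obj Y.unop))
  FΛ_map f b hb := T.FΛ_map (F.map f.unop).op b hb
  cnstR Y := T.cnstR (op (F.obj Y.unop))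
  cnstR_map f x hx := T.cnstR_map (F.map f.unop).op x hx
  divΛ_mem_cnstR Y b hb := T.divΛ_mem_cnstR (op (F.obj Y.unop)) b hb
  cnstR_root Y g n hg := T.cnstR_root (op (F.obj Y.unop)) g n hg
  cnst_le_cnstR Y b hb := T.cnst_le_cnstR (op (F.obj Y.unop)) b hb
  ncspR Y := T.ncspR (op (F.obj Y.unop))
  cspR Y := T.cspR (op (F.obj Y.unop))
  toR_ncsp Y x hx := T.toR_ncsp (op (F.obj Y.unop)) x hx
  toR_csp Y x hx := T.toR_csp (op (F.obj Y.unop)) x hx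

/-- The Def. 3.3 (iii) part of the base change is abc-iut-w5-d179's `DivisorMonoids.precomp` (definitionally).
[cite: MochizukiEtTh2009, Def 3.6 p.302 (PDF p.76)] -/
theorem precomp_toDivisorMonoids : (T.precomp F).toDivisorMonoids = T.toDivisorMonoids.precomp F := rfl

/-- The monoid type is unchanged by base change. [cite: MochizukiEtTh2009, Def 3.6 p.302 (PDF p.76)] -/
theorem precomp_Λ : (T.precomp F).Λ = T.Λ := rfl

/-- `Φ₀^ℝ` of the base change is `F.op ⋙ Φ₀^ℝ`. [cite: MochizukiEtTh2009, Def 3.6 p.302 (PDF p.76)] -/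
theorem precomp_ΦR : (T.precomp F).ΦR = F.op ⋙ T.ΦR := rfl

/-- `Φ₀^ℝ` of the base change, on objects. [cite: MochizukiEtTh2009, Def 3.6 p.302 (PDF p.76)] -/
theorem precomp_ΦR_obj (Y : D₁ᵒᵖ) : (T.precomp F).ΦR.obj Y = T.ΦR.obj (op (F.obj Y.unop)) := rfl

/-- `Φ₀^ℝ` of the base change, on morphisms. [cite: MochizukiEtTh2009, Def 3.6 p.302 (PDF p.76)] -/
theorem precomp_ΦR_map {Y Y' : D₁ᵒᵖ} (f : Y ⟶ Y') : (T.precomp F).ΦR.map f = T.ΦR.map (F.map f.unop).op := rfl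

/-- `B₀^Λ` of the base change is `F.op ⋙ B₀^Λ`. [cite: MochizukiEtTh2009, Def 3.6 p.302 (PDF p.76)] -/
theorem precomp_BΛ : (T.precomp F).BΛ = F.op ⋙ T.BΛ := rfl

/-- `B₀^Λ` of the base change, on objects. [cite: MochizukiEtTh2009, Def 3.6 p.302 (PDF p.76)] -/
theorem precomp_BΛ_obj (Y : D₁ᵒᵖ) : (T.precomp F).BΛ.obj Y = T.BΛ.obj (op (F.obj Y.unop)) := rfl

/-- `Φ₀ → Φ₀^ℝ` of the base change. [cite: MochizukiEtTh2009, Def 3.6 p.302 (PDF p.76)] -/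
theorem precomp_toR (Y : D₁ᵒᵖ) : (T.precomp F).toR Y = T.toR (op (F.obj Y.unop)) := rfl

/-- `B₀^Λ → (Φ₀^ℝ)^gp` of the base change. [cite: MochizukiEtTh2009, Def 3.6 p.302 (PDF p.76)] -/
theorem precomp_divΛ (Y : D₁ᵒᵖ) : (T.precomp F).divΛ Y = T.divΛ (op (F.obj Y.unop)) := rfl

/-- `F₀^Λ` of the base change. [cite: MochizukiEtTh2009, Def 3.6 p.302 (PDF p.76)] -/
theorem precomp_FΛ (Y : D₁ᵒᵖ) : (T.precomp F).FΛ Y = T.FΛ (op (F.obj Y.unop)) := rfl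

/-- `ℝ·Φ₀^cnst` of the base change. [cite: MochizukiEtTh2009, Def 3.6 p.302 (PDF p.76)] -/
theorem precomp_cnstR (Y : D₁ᵒᵖ) : (T.precomp F).cnstR Y = T.cnstR (op (F.obj Y.unop)) := rfl

/-- The non-cuspidal part of the base change. [cite: MochizukiEtTh2009, Def 3.6 p.303 (PDF p.77)] -/
theorem precomp_ncspR (Y : D₁ᵒᵖ) : (T.precomp F).ncspR Y = T.ncspR (op (F.obj Y.unop)) := rfl

/-- The cuspidal part of the base change. [cite: MochizukiEtTh2009, Def 3.6 p.303 (PDF p.77)] -/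
theorem precomp_cspR (Y : D₁ᵒᵖ) : (T.precomp F).cspR Y = T.cspR (op (F.obj Y.unop)) := rfl

end RealifiedDivisorMonoids

/-! ## §2. Re-basing a tempered Frobenioid onto its own base category (`D₀ := D`, `base := 𝟭`) -/

namespace TemperedFrobenioid

variable {D₀ : Type u₀} [Category.{v₀} D₀] {V : FrdIMonoidStub.{w}} {T : RealifiedDivisorMonoids (D₀ := D₀) V}
  {D : Type u} [Category.{v} D] {VD : FrdICatStub.{u, v, w} D} (C : TemperedFrobenioid T D VD)

/-- **Re-basing** (§4 p.312 «`D := D₀[𝒟] (⊆ D₀)`»; §5 p.322 «`Φ := Φ^ell_α` on `D := D_α` … over the base category `D`»;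
Ex. 3.9 (iv) p.311 «special cases of "`D_α`"»): the Def. 3.6 (ii) datum `(D, D → D₀, Φ ⊆ Φ₀^ℝ|_D)` re-referenced to the
Def. 3.6 (i) data whiskered along its own structure functor, `D₀ := D`, `D → D₀ := 𝟭_D` — the divisor monoid `Φ`,
every clause of Def. 3.6 (ii) and (below) the resulting model category are unchanged.
[cite: MochizukiEtTh2009, Def 3.6 p.302 (PDF p.76); §4 p.312 (PDF p.86); §5 p.322 (PDF p.96)] -/
def rebase : TemperedFrobenioid (T.precomp C.base) D VD where
  isConnected := C.isConnected
  isTotallyEpimorphic := C.isTotallyEpimorphic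
  base := 𝟭 D
  Φ := { carrier := fun A => C.Φ.carrier A
         map_mem := fun f x hx => C.Φ.map_mem f x hx }
  isGroupSaturated A := C.isGroupSaturated A
  isPerfFactorial A := C.isPerfFactorial A
  isDivisorialOn := C.isDivisorialOn
  isMonoprime_bsFld A := C.isMonoprime_bsFld A
  exists_FΛ_div_ne A := C.exists_FΛ_div_ne A

/-- The structure functor of the re-based datum is the identity. [cite: MochizukiEtTh2009, Def 3.6 p.302 (PDF p.76)] -/
theorem rebase_base : C.rebase.base = 𝟭 D := rfl

/-- The divisor monoid `Φ(A)` is unchanged by re-basing. [cite: MochizukiEtTh2009, Def 3.6 p.302 (PDF p.76)] -/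
theorem rebase_Φ_carrier (A : Dᵒᵖ) : C.rebase.Φ.carrier A = C.Φ.carrier A := rfl

/-- `Φ^{ℝ-log}` is unchanged by re-basing (`(𝟭_D)^op ⋙ (base^op ⋙ Φ₀^ℝ)` computes to `base^op ⋙ Φ₀^ℝ` on objects and
arrows). [cite: MochizukiEtTh2009, Def 3.6 p.302 (PDF p.76)] -/
theorem rebase_ΦRlog_obj (A : Dᵒᵖ) : C.rebase.ΦRlog.obj A = C.ΦRlog.obj A := rfl

/-- The divisor monoid as a functor on `D` is unchanged by re-basing. [cite: MochizukiEtTh2009, Def 3.6 p.303 (PDF p.77)] -/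
theorem divisorMonoid_rebase : C.rebase.divisorMonoid = C.divisorMonoid := rfl

/-- The monoid type is unchanged by re-basing. [cite: MochizukiEtTh2009, Def 3.6 p.303 (PDF p.77)] -/
theorem monoidType_rebase : C.rebase.monoidType = C.monoidType := rfl

/-- `Φ^{bs-fld}(A)` is unchanged by re-basing (`(ℝ·Φ₀^cnst)|_D` is read at the same objects).
[cite: MochizukiEtTh2009, Def 3.6 p.303 (PDF p.77)] -/
theorem bsFld_rebase_carrier (A : Dᵒᵖ) : C.rebase.bsFld.carrier A = C.bsFld.carrier A := rfl

/-- The rational-function monoid `B(A)` is unchanged by re-basing. [cite: MochizukiEtTh2009, Def 3.6 p.303 (PDF p.77)] -/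
theorem ratFn_rebase (A : Dᵒᵖ) : C.rebase.ratFn A = C.ratFn A := rfl

/-- `B` as a monoid on `D` is unchanged by re-basing. [cite: MochizukiEtTh2009, Def 3.6 p.303 (PDF p.77)] -/
theorem ratFnFunctor_rebase : C.rebase.ratFnFunctor = C.ratFnFunctor := rfl

/-- `Div_B : B → Φ^gp` is unchanged by re-basing. [cite: MochizukiEtTh2009, Def 3.6 p.303 (PDF p.77)] -/
theorem divBNatTrans_rebase : C.rebase.divBNatTrans = C.divBNatTrans := rfl

/-- **The model category is unchanged by re-basing**: `(D, Φ, B, B → Φ^gp)` is the same data, hence «the data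
`(D, Φ, B, B → Φ^gp)` determines a model Frobenioid `C`» (Def. 3.6 (ii) p.303) gives literally the same category — every
§4/§5 carrier built on `C` is a carrier on `C.rebase`. [cite: MochizukiEtTh2009, Def 3.6 p.303 (PDF p.77)] -/
theorem category_rebase : C.rebase.category = C.category := rfl

/-- The constant-function monoid `F(A)` is unchanged by re-basing. [cite: MochizukiEtTh2009, Def 3.6 p.303 (PDF p.77)] -/
theorem cnstFn_rebase (A : Dᵒᵖ) : C.rebase.cnstFn A = C.cnstFn A := rfl

/-- Rationality (a property of `Φ` alone, p.303) is unchanged by re-basing.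
[cite: MochizukiEtTh2009, Def 3.6 p.303 (PDF p.77)] -/
theorem isRational_rebase_iff : C.rebase.IsRational ↔ C.IsRational := Iff.rfl

/-- Non-cuspidality of a divisor is unchanged by re-basing (Def. 3.6 (iii)).
[cite: MochizukiEtTh2009, Def 3.6 p.303 (PDF p.77)] -/
theorem isNonCuspidal_rebase_iff {A : Dᵒᵖ} (x : C.Φ.carrier A) :
    C.rebase.IsNonCuspidal (A := A) x ↔ C.IsNonCuspidal x := Iff.rfl

/-- Cuspidality of a divisor is unchanged by re-basing (Def. 3.6 (iii)). [cite: MochizukiEtTh2009, Def 3.6 p.303 (PDF p.77)] -/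
theorem isCuspidal_rebase_iff {A : Dᵒᵖ} (x : C.Φ.carrier A) :
    C.rebase.IsCuspidal (A := A) x ↔ C.IsCuspidal x := Iff.rfl

/-! ### The base-shape clauses of `BiKummerSetting.Thm44Hyp` for a re-based datum -/

/-- The structure functor `𝟭_D` of the re-based datum is full («`D₁ := B^temp(X₁^log)[𝒟₁]`» is a FULL subcategory of
the reference category — here all of it). [cite: MochizukiEtTh2009, Thm 4.4 p.319 (PDF p.93)] -/
theorem rebase_base_full : C.rebase.base.Full := Functor.Full.id

/-- The structure functor `𝟭_D` of the re-based datum is faithful. [cite: MochizukiEtTh2009, Thm 4.4 p.319 (PDF p.93)] -/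
theorem rebase_base_faithful : C.rebase.base.Faithful := Functor.Faithful.id

/-- For the re-based datum the essential image of the structure functor is everything, i.e. `D₀[𝒟]` for any weakly
terminal object `𝒟` of `D` (an object to which every object maps — print's `𝒟` with `D = D₀[𝒟]`, §4 p.312).
[cite: MochizukiEtTh2009, §4 p.312 (PDF p.86)] -/
theorem essImage_rebase_iff {𝒟 : D} (h𝒟 : ∀ Y : D, Nonempty (Y ⟶ 𝒟)) (Y : D) :
    (∃ A : D, Nonempty (C.rebase.base.obj A ≅ Y)) ↔ Nonempty (Y ⟶ 𝒟) :=
  ⟨fun _ => h𝒟 Y, fun _ => ⟨Y, ⟨Iso.refl Y⟩⟩⟩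

/-- **The three clauses of `BiKummerSetting.Thm44Hyp.baseShape_i` HOLD for a re-based datum** over a base category with
a weakly terminal object `𝒟`: `Full ∧ Faithful ∧ ∃ 𝒟, ∀ Y, (∃ A, Nonempty (base A ≅ Y)) ↔ Nonempty (Y ⟶ 𝒟)` — stated in
exactly the shape of that field (abc-iut-L2-t3, `BiKummerRoots.lean`).  Contrast abc-iut-L2-t9's
`Example39Data.not_full_toDW_id_of_ne` for the un-re-based Example 3.9 (iv) datum.
[cite: MochizukiEtTh2009, Thm 4.4 p.319 (PDF p.93); §4 p.312 (PDF p.86)] -/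
theorem baseShape_rebase {𝒟 : D} (h𝒟 : ∀ Y : D, Nonempty (Y ⟶ 𝒟)) :
    C.rebase.base.Full ∧ C.rebase.base.Faithful ∧
      ∃ 𝒟 : D, ∀ Y : D, (∃ A : D, Nonempty (C.rebase.base.obj A ≅ Y)) ↔ Nonempty (Y ⟶ 𝒟) :=
  ⟨C.rebase_base_full, C.rebase_base_faithful, 𝒟, C.essImage_rebase_iff h𝒟⟩

end TemperedFrobenioid

/-! ## §3. Example 3.9 (iv) at `α = 𝟙_A`, re-referenced to `(D_W)_A = D_{𝟙_A}` (§5 p.322) -/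

namespace Example39Data

variable {V : FrdIMonoidStub.{w}} {DW : Type u} [Category.{v} DW] {TW : RealifiedDivisorMonoids (D₀ := DW) V}
  (E : Example39Data V DW TW) (A : DW)

/-- **Example 3.9 (iv) at `α = 𝟙_A`, re-based** (§5 p.322 «Suppose further that the morphism `α : A → B` of Example
3.9, (iv), is the identity morphism … `Φ := Φ^ell_α` on `D := D_α` … determines a tempered Frobenioid `C` … over the base
category `D`»; Ex. 3.9 (iv) p.311 «`D_X` … special cases of "`D_α`"»): abc-iut-L2-t3's `E.thetaFrobenioid (𝟙 A) h` with
its Def. 3.6 (i) data pulled back along `D_{𝟙_A} → D_W` and structure functor `𝟭`, i.e. with REFERENCE CATEGORY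
`D₀ := (D_W)_A = D_{𝟙_A}` itself. [cite: MochizukiEtTh2009, §5 p.322 (PDF p.96); Ex 3.9 (iv) p.311 (PDF p.85)] -/
def thetaFrobenioidRebase {VD : FrdICatStub.{max u v, v, w} (Dα (𝟙 A))} (h : E.FrobenioidHyp (𝟙 A) VD) :
    TemperedFrobenioid (TW.precomp (toDW (𝟙 A))) (Dα (𝟙 A)) VD :=
  (E.thetaFrobenioid (𝟙 A) h).rebase

variable {VD : FrdICatStub.{max u v, v, w} (Dα (𝟙 A))} (h : E.FrobenioidHyp (𝟙 A) VD)

/-- The re-based Example 3.9 (iv) datum IS `(E.thetaFrobenioid (𝟙 A) h).rebase` (definitionally).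
[cite: MochizukiEtTh2009, §5 p.322 (PDF p.96)] -/
theorem thetaFrobenioidRebase_eq : E.thetaFrobenioidRebase A h = (E.thetaFrobenioid (𝟙 A) h).rebase := rfl

/-- Its divisor monoid is `Φ^ell_{𝟙_A}` (unchanged). [cite: MochizukiEtTh2009, Ex 3.9 (iv) p.311 (PDF p.85)] -/
theorem thetaFrobenioidRebase_Φ_carrier (Y : (Dα (𝟙 A))ᵒᵖ) :
    (E.thetaFrobenioidRebase A h).Φ.carrier Y = (E.Φα (𝟙 A)).carrier Y := rfl

/-- Its model category is that of `E.thetaFrobenioid (𝟙 A) h` («the tempered Frobenioid `C`» of §5 is ONE category,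
whichever reference is used). [cite: MochizukiEtTh2009, §5 p.322 (PDF p.96)] -/
theorem category_thetaFrobenioidRebase :
    (E.thetaFrobenioidRebase A h).category = (E.thetaFrobenioid (𝟙 A) h).category := rfl

/-- Its structure functor is `𝟭`. [cite: MochizukiEtTh2009, §5 p.322 (PDF p.96)] -/
theorem thetaFrobenioidRebase_base : (E.thetaFrobenioidRebase A h).base = 𝟭 (Dα (𝟙 A)) := rfl

/-- Its monoid type is that of `Φ^ell_W` (for the genuine data: `ℤ`, «of monoid type `ℤ`» p.322).
[cite: MochizukiEtTh2009, §5 p.322 (PDF p.96)] -/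
theorem monoidType_thetaFrobenioidRebase : (E.thetaFrobenioidRebase A h).monoidType = TW.Λ := rfl

omit E in
/-- The object `(A, 𝟙_A)` of `D_{𝟙_A} = (D_W)_A[𝟙_A]` is weakly terminal: every object `(Y → A)` maps to it (abc-iut-L2-t3's
`admitsMorphismTo_mk_id`; print: «`D_X` … obtained by taking "`α`" to be the identity morphism», p.311).
[cite: MochizukiEtTh2009, Ex 3.9 (iv) p.311 (PDF p.85)] -/
theorem nonempty_hom_mkId (Y : Dα (𝟙 A)) :
    Nonempty (Y ⟶ (⟨Over.mk (𝟙 A), admitsMorphismTo_self (Over.mk (𝟙 A))⟩ : Dα (𝟙 A))) := by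
  obtain ⟨f⟩ := Y.property
  exact ⟨(admitsMorphismTo (Over.mk (𝟙 A))).homMk f⟩

/-- **The base-shape clauses of `Thm44Hyp` HOLD for the re-based Example 3.9 (iv) datum** («`D_i := B^temp(X_i^log)[𝒟_i]`»,
Thm. 4.4 p.319, with `𝒟 := (A, 𝟙_A)`): `Full ∧ Faithful ∧ ∃ 𝒟, essImage = D₀[𝒟]` — whereas for the un-re-based
`E.thetaFrobenioid (𝟙 A) h` the clause «Full» fails whenever `Aut_{D_W}(A) ≠ 1` (abc-iut-L2-t9, p432820).  This is the input
`hshape` of abc-iut-L2-t9's `BiKummerSetting.exists_thm44Hyp_self` for §5 data built on the re-based datum.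
[cite: MochizukiEtTh2009, Thm 4.4 p.319 (PDF p.93); §5 p.322 (PDF p.96)] -/
theorem baseShape_thetaFrobenioidRebase :
    (E.thetaFrobenioidRebase A h).base.Full ∧ (E.thetaFrobenioidRebase A h).base.Faithful ∧
      ∃ 𝒟 : Dα (𝟙 A), ∀ Y : Dα (𝟙 A),
        (∃ Z : Dα (𝟙 A), Nonempty ((E.thetaFrobenioidRebase A h).base.obj Z ≅ Y)) ↔ Nonempty (Y ⟶ 𝒟) :=
  (E.thetaFrobenioid (𝟙 A) h).baseShape_rebase (nonempty_hom_mkId A)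

end Example39Data

end Literature.AnabelianGeometry.EtaleTheta

end
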